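import Summits.QuantumFields.YangMills.Theorems.BalabanUVNodesN27AtRecordShadow
import Literature.MathematicalPhysics.QuantumFieldTheory.Balaban1983to89.Node00.Record10

/-!
# BalabanUVNodes ∕ N27 = binder B5 AT THE RECORD, XIX — the (W2′) shadow closer AT NODE 00's STAGE-10 RECORD PREDICATE `Node00.IsRecordOfRecord₁₀C`
# (`Node00/Record10.lean`): `Spine Rec₅C → Spine Rec₁₀C` in ONE application of XVI's `spine_of_shadow` to Record10's refinement-at-the-shadow lemma
# `Node00.exists_isRecordOfRecord₅C_of_isRecordOfRecord₁₀C` (same world; shadow datum with the same `C`, `dens`, `βfun`, `av` — B5 needs `C` and `av`) —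
# the ₁₀ twin of XVIII (`…N27AtRecord9`)
# (cell `pub-ymgap`, HUMAN RULING D-0062 Track A, seat `pub-ymgap-dag-n27-a` g4; `--supports stmt-QuantumFields-19182`, count-neutral)

HONEST FRAMING.  Bookkeeping by name; the premise `Spine Rec₅C` (B5 at every Stage-5 C-bound record) has NO producer today (N19 ∕ N20 ∕ N21 ∕ N27x are 0∕1
at every record); nothing of Bałaban's asserted; NO node discharged; typed 28∕28, count untouched; one finite four-torus programme — NOT ℝ⁴, NOT infinite
volume, NOT OS, NOT a mass gap, NOT Clay.  Restate-immune.  No decl below carries a cite tag.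
-/

namespace Summit.QuantumFields.YangMills.Theorems.BalabanUVNodesN27SpineRecord

open Literature.MathematicalPhysics.QuantumFieldTheory.Balaban1983to89
open Literature.MathematicalPhysics.QuantumFieldTheory.Balaban1983to89.T4Continuum
open YMDAG.UVSplit

variable {N : ℕ} [NeZero N]

/-- **B5 AT ONE STAGE-10 RECORD PAIR from `Spine` at the ₅C record predicate**: the world of a ₁₀C record is a ₅C record at the shadow datum, which has the
same `C` and `av` (`Node00.exists_isRecordOfRecord₅C_of_isRecordOfRecord₁₀C`), and B5 reads nothing else of the datum (XVI `b5_congr`). [bookkeeping] -/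
theorem b5_of_isRecordOfRecord₁₀C (h₅ : Spine (N := N) fun F D w => Node00.IsRecordOfRecord₅C F N D w)
    {F : T4Family} {D : Datum F N} {w : DagBinding.WorldP} (h : Node00.IsRecordOfRecord₁₀C F N D w) :
    T4ApexHybrid.HybridNE7Under D (DagBinding.EndpointExistence D.C.toB12) := by
  obtain ⟨D₅, h5, hC, -, -, hav⟩ := Node00.exists_isRecordOfRecord₅C_of_isRecordOfRecord₁₀C h
  exact (b5_congr hC hav).mp (h₅ F D₅ w h5)

/-- **THE ₁₀C CLOSER OF THE COMPOSITE NODE**: `Spine Rec₅C → Spine Rec₁₀C` — one application of XVI `spine_of_shadow` to Record10's refinement at the shadow.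
[bookkeeping] -/
theorem spine_rec10C_of_spine_rec5C (h₅ : Spine (N := N) fun F D w => Node00.IsRecordOfRecord₅C F N D w) :
    Spine (N := N) fun F D w => Node00.IsRecordOfRecord₁₀C F N D w :=
  spine_of_shadow (Rec' := fun F D w => Node00.IsRecordOfRecord₅C F N D w) (fun F D w h => by
    obtain ⟨D₅, h5, hC, -, -, hav⟩ := Node00.exists_isRecordOfRecord₅C_of_isRecordOfRecord₁₀C h
    exact ⟨D₅, h5, hC, hav⟩) h₅

/-- Antitone corollary: B5 at ANY record predicate coarser than ₅C gives B5 at ₁₀C. [bookkeeping] -/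
theorem spine_rec10C_of_coarser {Rec : RecordPred N}
    (hle : ∀ (F : T4Family) (D : Datum F N) (w : DagBinding.WorldP), Node00.IsRecordOfRecord₅C F N D w → Rec F D w) (h : Spine Rec) :
    Spine (N := N) fun F D w => Node00.IsRecordOfRecord₁₀C F N D w :=
  spine_rec10C_of_spine_rec5C (spine_antitone hle h)

end Summit.QuantumFields.YangMills.Theorems.BalabanUVNodesN27SpineRecord
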